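import Literature.MathematicalPhysics.QuantumFieldTheory.Balaban1983to89.B2Eq266HiggsRegion
import Literature.MathematicalPhysics.QuantumFieldTheory.Balaban1983to89.B2Eq265Restrictions255

/-!
# `Balaban1983to89.B2Eq266Restrictions255` — [Balaban1982Higgs2] **Lemma 2.4 (2.66), THE DERIVATIVE CLAUSE, «Under the restrictions
# (2.55)»** p. 572 ON THE (Higgs)₂,₃ CARRIER OF RECORD: own D5 `B2Eq266HiggsRegion.eq266_higgs_region` with its four data items
# (the Lipschitz modulus `λ` of the gauged field, the constant field `A₀`/`s`, the far-radius `ρ`, and the sup bound `t′`) READ OFF the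
# printed hypotheses exactly as p23's F6–F9 read them for the value clause (2.65) — by name, in one step

statement-level skeleton of published theorems with citation tags; proofs where landed; nothing here is a claim
about the Yang–Mills mass gap

PDF held: `paper:balaban1982-cmp86-higgs23-ii` (journal page = PDF page + 554), p. 570 [PDF 16] ((2.55)), p. 572 [PDF 18] (Lemma 2.4,
the □₁/□₂ sentence), p. 573 [PDF 19] (the two displayed lines before (2.75), (2.77)) — renders/text layer of record, re-read this session
for (2.66)/(2.77) (see D5).

CITATION HEADER (lean-in-tree rule).  T. Bałaban, *(Higgs)₂,₃ quantum fields in a finite volume. II. An upper bound*,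
Commun. Math. Phys. **86** (1982) 555–594, doi:10.1007/bf01214890 [Balaban1982Higgs2]; part I [Balaban1982Higgs1] AS TYPED.  Cell
`lit-balaban` (HOME `run/shared/lean/pub/lit-balaban/`), reader/typer seat **r14** gen 21 (B2 second reader; unit `lit-balaban-r14-g21`;
free-target protocol G.5-34(d): the derivative lane of row B2.Lem2.4; TAKING line HOME/STATUS.md for this stem); SKELETON row
**B2.Lem2.4** (fold owner r02, second reader r14; decl of record `B2.Lemma24Printed`, head `proved p250408 · …` UNCHANGED — cells-only
member, an OPTIONAL TWIN of p23's F6–F9 for the derivative clause, zero head weight by the owner's ruling 2026-08-23T09:30Z).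
USED BY NAME, never restated: own D5 `B2Eq266HiggsRegion.eq266_higgs_region`; p23's F6 `B2Eq265GaugedLipschitz.{cov_const_of_cov_barA,
lipschitz_about_of_bond_bound}` + F5 `B2Eq265HiggsRegion.norm_rot_cornerGauge_shift_sub` (λ of the gauged field from the covariant per-bond
bound), F7 `B2Eq265ConstantPart.abs_sub_corner_le_of_grad` (`A₀ := A(q̄)`, `s := δ_A·d·LᵏS`), F8 `B2Eq265CentredBox.{tdist_ge_of_not_mem_box,
mem_box_of_centre, reg223_of_grad}` (`ρ := R₁ + 1`, one regularity hypothesis), F9 `B2Eq265Restrictions255.{norm_le_of_restr255,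
norm_transport_sub_le_of_restr255}` (`t′`, `λ_A` from (2.55)₃,₄), the typer's `B2Eq255Concrete.{Restr255, barA}`.

WHAT IS PRINTED (p. 570, p. 572, p. 573).  (2.55): *«|(∂A)(b)| ≦ c₁p(L^{k−1}ε), |A(x)| ≦ c₁/(μ₀L^{k−1}ε)·p(L^{k−1}ε), |(D_{Ā^{(k)}}φ)(b)| ≦
c₁p(L^{k−1}ε), |φ(x)| ≦ c₁/λ(L^{k−1}ε)^{1/4}·p(L^{k−1}ε) for x ∈ Λ₋₁^{(k−1)′}, b ⊂ Λ₋₁^{(k−1)′}»*; Lemma 2.4: *«Under the restrictions (2.55)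
we have … (D^η_{A^{(k)}}φ^{(k)})(b) = O(p(Lᵏε)) for b ⊂ Bᵏ(Λ₇^{(k−1)′}). (2.66)»*; p. 573 ends with (2.77) «(D^η_{A^{(k)}}φ^{(k)})(b) =
U(A₀(Γ_{b₋,y}))(a_k∂^ηG_k(□, 0)Q_k^*□₁φ′)(b) + O((Lᵏε)^{κ₀}), b ⊂ □»; p. 574 [PDF 20], top: *«Using again the similar considerations as in
the proof of Lemma 2.3 we get (2.66). This ends the proof of Lemma 2.4.»* — ALL print gives for the step (2.77) ⇒ (2.66) (renders
p016/p018/p019/p020 of record).  [v1.1 DOC-ONLY, referee ref-4 g68 finding S-B2-g68-1 / ask D-g68-1: v1.0 quoted here and in the cite tag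
of `eq266_higgs_region_restr255`, inside «…», a sentence «Now reasoning similarly as in the proof of (2.76) and using the inequalities
|φ′(y″) − φ′(y′)| ≤ O(1)p(Lᵏε) for y′, y″ ∈ □₁, we get … hence, finally, (2.66)» that is NOT PRINTED (it was D5's own gloss of the argument;
the bound |φ′(y″) − φ′(y′)| ≦ O(1)p(Lᵏε) itself IS printed on p. 573 before (2.75)); replaced by the printed p. 574 sentence; code
byte-identical.]

WHAT THIS FILE PROVES (kernel-checked, zero `sorry`; one theorem — NO definition, NO `Prop`-valued fact; axioms standard).
 **`eq266_higgs_region_restr255`** = D5's `eq266_higgs_region` with the located edits of p23's F6→F9 chain applied to ITS letters, i.e.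
 p23's F9 `B2Eq265Restrictions255.eq265_higgs_region_restr255` hypothesis list word for word plus D5's `(μ : Fin P.d)` and integer depth
 `m₀` (`1 ≤ m₀`, `{|z − x| ≤ Lᵏm₀} ⊂ □`), and D5's bound with `t′ ↦ c₁·tPhi·pℓ`, `λ ↦ (Lᵏε(c₁pℓ) + Lᵏε|e|st′)·d`, `s ↦ δ_A·d·(LᵏS)`,
 `ρ ↦ R₁ + 1` at every occurrence (F6: λ; F7: A₀ := A(q̄), s; F8: □₁ centred at ȳ, ρ, one regularity hypothesis; F9: (2.55)₃,₄).

HONEST SCOPE / DIFFERENCES FROM PRINT (recorded, not hidden).  (a) Everything of D5's HONEST SCOPE (a)–(g) and of F9's stands; in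
particular the regularity `δ_A` of `A = A^{(k)}` on `Bᵏ(Λ₂′)` is still a HYPOTHESIS here (its feeding from (2.55)₁,₂ through Lemma 2.3 is
p23's F10/F12a/F12 for the value clause; the derivative twin of that step is NOT done here), as are the box data `□₂ = q + [0,S)ᵈ`,
`□₁` the centred cube of radius `R₁`, `x` deep with integer depth `m₀`, and the layer factor `(Π_ν|S_ν|)K₀^{d−1}m₀^{−d}`.  (b) Value: the
derivative clause (2.66) now stands on the carrier «under the restrictions (2.55)» for `φ` EXACTLY as the value clause did at p23's F9
(v2.16x): the φ-data gone, `A^{(k)}`'s regularity one hypothesis; NOT summit progress; optional twin, zero head weight.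
-/

open scoped BigOperators

noncomputable section

namespace Literature.MathematicalPhysics.QuantumFieldTheory.Balaban1983to89.B2Eq266Restrictions255

open HiggsLattice (ChargeData covDeriv)
open HiggsAveraging (blockIter toFinest)
open HiggsCovariancePos (Inside)
open HiggsGaugeInvariance (rot)
open B2Eq255Concrete (bgScalar256 underRegion mem_underRegion barA Restr255)
open B2Eq266HiggsRegion (eq266_higgs_region)
open B2Eq265HiggsRegion (norm_rot_cornerGauge_shift_sub)
open B2Eq265GaugedLipschitz (cov_const_of_cov_barA lipschitz_about_of_bond_bound)
open B2Eq265ConstantPart (abs_sub_corner_le_of_grad)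
open B2Eq265CentredBox (tdist_ge_of_not_mem_box mem_box_of_centre reg223_of_grad)
open B2Eq265Restrictions255 (norm_le_of_restr255 norm_transport_sub_le_of_restr255)
open B2Eq273GaugeCovariance (cornerGauge)
open B1Ineq225RegularBox (cellBox)
open B1Ineq234Concrete (distC)
open B1TorusRegionHSizes (IsBigBlockUnion)
open B1TorusCubeCover (half)
open B1TorusCubeLocality26 (rS)

variable {P : HiggsLattice.Params} {N : ℕ}

/-! ## (2.66) under the restrictions (2.55) -/

section Eq266Restr

/-- **LEMMA 2.4 (2.66), DERIVATIVE CLAUSE, ON THE (Higgs)₂,₃ CARRIER — «Under the restrictions (2.55)».**  TYPED vs PRINTED: own D5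
`B2Eq266HiggsRegion.eq266_higgs_region` with p23's F6–F9 located edits: `□₂` IS the box `q + [0,S)ᵈ` (`∀ y, y ∈ □₂ ↔ …`, `2LᵏS ≤ |T_ε|_μ`),
`□₁ :=` the cube of coarse sites of radius `R₁` centred at `ȳ = x_k` (`n_ν(ȳ − q₁) = R₁`; `ρ ↦ R₁ + 1`), the two regularity hypotheses
REPLACED by the small-gradient form `|A_{⟨z+e_ν,μ⟩} − A_{⟨z,μ⟩}| ≤ δA` on `Bᵏ(Λ₂′)` with `LᵏδA|e| ≤ t`, `Lᵏ(Lᵏε)|e|δA ≤ c_reg e_k^β`, the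
constant field and `s` GONE (`A₀ := A(q̄)`, `s ↦ δA·d·(LᵏS)`), the four `φ`-items REPLACED by `Λ₋₁ ⊇ Λ₆′`, `A′`, `c₁ pℓ tA tPhi ≥ 0` and ONE
hypothesis `Restr255 C c₁ pℓ tA tPhi k Λ₋₁ A′ φ A` (`t′ ↦ c₁·tPhi·pℓ`, `λ ↦ (Lᵏε(c₁pℓ) + Lᵏε|e|s·t′)·d`); D5's `(μ : Fin P.d)` and integer
depth `m₀` kept. [cite: Balaban1982Higgs2, Lemma 2.4 (2.66) p.572] [cite: Balaban1982Higgs2, (2.55) p.570]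
[cite: Balaban1982Higgs2, Lemma 2.4 proof (2.77) p.573, p.574 «Using again the similar considerations as in the proof of Lemma 2.3 we get (2.66).»] -/
theorem eq266_higgs_region_restr255 (d L : ℕ) (hd : 1 ≤ d) (hL : 2 ≤ L) {a : ℝ} (ha : 0 < a) {msq : ℝ} (hmsq : 0 < msq)
    (N : ℕ) (C : ChargeData N) (ε₀ : ℝ) (creg β : ℝ) (hcreg : 0 ≤ creg) (hβ : 0 < β) :
    ∃ K₀min : ℕ, ∀ K₀ : ℕ, K₀min ≤ K₀ → ∃ e₁ t : ℝ, 0 < e₁ ∧ 0 < t ∧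
      ∃ C₁ C₂ C₃ D₂ D₃ D₄ D₅ : ℝ, 0 ≤ C₁ ∧ 0 ≤ C₂ ∧ 0 ≤ C₃ ∧ 0 ≤ D₂ ∧ 0 ≤ D₃ ∧ 0 ≤ D₄ ∧ 0 ≤ D₅ ∧
      ∀ (P : HiggsLattice.Params), P.d = d → P.L = L → K₀ ∣ P.M →
      ∀ {k : ℕ}, 1 ≤ k → k ≤ P.K → (∀ μ, 3 * half P k K₀ ≤ P.sitesPerDir 0 μ) → P.mesh k ≤ ε₀ → P.mesh k ≤ 1 →
      ∀ (Λ₂ Λ₆ sq₂ sq₁ : Finset (HiggsLattice.Site P k)) (S : Fin P.d → Finset ℕ) (q : HiggsLattice.Site P k) (Sbox : ℕ),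
        Λ₆ ⊆ Λ₂ → sq₂ ⊆ Λ₂ → sq₁ ⊆ sq₂ → sq₁ ⊆ Λ₆ →
        IsBigBlockUnion k K₀ (underRegion k Λ₂) → underRegion k sq₂ = cellBox k K₀ S →
        (∀ μ : Fin P.d, P.L ^ k * Sbox < P.sitesPerDir 0 μ) →
      -- `□₂` IS the box `q + [0,S)ᵈ` of coarse sites, `□ = B^k(□₂)` smaller than half the torus
        (∀ y : HiggsLattice.Site P k, y ∈ sq₂ ↔ ∀ ν : Fin P.d, (y ν - q ν).val < Sbox) →
        (∀ μ : Fin P.d, 2 * (P.L ^ k * Sbox) ≤ P.sitesPerDir 0 μ) →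
      -- `□₁` is the box of coarse sites of radius `R₁` about `ȳ` (corner `q₁`), smaller than half the torus
      ∀ (q₁ : HiggsLattice.Site P k) (R₁ : ℕ), (∀ μ : Fin P.d, 2 * (2 * R₁ + 1) ≤ P.sitesPerDir k μ) →
        (∀ y : HiggsLattice.Site P k, y ∈ sq₁ ↔ ∀ ν : Fin P.d, (y ν - q₁ ν).val < 2 * R₁ + 1) →
      -- ONE regularity hypothesis: the small-gradient form on `B^k(Λ₂)`, small in the two printed scalings
      ∀ (A : HiggsLattice.VecField P 0) {δA : ℝ}, 0 ≤ δA →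
          (∀ z ∈ underRegion k Λ₂, ∀ μ ν : Fin P.d, |A ⟨z.shift ν, μ⟩ - A ⟨z, μ⟩| ≤ δA) →
          (P.L : ℝ) ^ k * δA * |C.e| ≤ t →
        ∀ {ec : ℝ}, 0 < ec → ec ≤ e₁ → (P.L : ℝ) ^ k * P.mesh k * |C.e| * δA ≤ creg * ec ^ β →
      -- the bond `⟨x, x + εe_μ⟩`, `x` deep in `□` (the `(2.67)`/`(2.76)` depth and the integer depth `m₀` of the layer term), `ȳ = x_k` the centre of `□₁`
      ∀ (x : HiggsLattice.Site P 0) (μ : Fin P.d),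
        (∀ z, HiggsLattice.Site.tdist x z ≤ 2 * rS P k K₀ + 2 * half P k K₀ * (P.d + 1) + 1 → z ∈ underRegion k sq₂) →
        ∀ (m₀ : ℕ), 1 ≤ m₀ → (∀ z, HiggsLattice.Site.tdist x z ≤ P.L ^ k * m₀ → z ∈ underRegion k sq₂) →
        (∀ ν : Fin P.d, ((blockIter k x) ν - q₁ ν).val = R₁) →
      -- the restrictions (2.55) on a coarse region `Λ₋₁ ⊇ Λ₆` for the fields `A′, φ` of the step and the background `A^{(k)} = A`
      ∀ (φ : HiggsLattice.ScalarField P k N) (Λm1 : Finset (HiggsLattice.Site P k)) (A' : HiggsLattice.VecField P k)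
        {c₁ pℓ tA tPhi : ℝ}, 0 ≤ c₁ → 0 ≤ pℓ → 0 ≤ tPhi → Λ₆ ⊆ Λm1 →
        Restr255 C c₁ pℓ tA tPhi k Λm1 A' φ A →
        ‖covDeriv C A (bgScalar256 C msq a k Λ₂ Λ₆ A φ) (⟨x, μ⟩ : HiggsLattice.PBond P 0)‖
          ≤ B1.aSeq a P.L k * (P.mesh k)⁻¹ * (c₁ * tPhi * pℓ) *
                (C₁ * Real.exp (-(1 / (4 * K₀) * (distC (underRegion k sq₂) x / (P.L : ℝ) ^ k)))
                  + C₂ * Real.exp (-(1 / (4 * K₀) * ((R₁ : ℝ) + 1))))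
            + (|C.e| * (δA * (P.d * ((P.L : ℝ) ^ k * Sbox))) * (B1.aSeq a P.L k * D₃ * (c₁ * tPhi * pℓ))
              + D₂ * P.mesh k *
                (B1.aSeq a P.L k * (P.mesh k)⁻¹ ^ 2 * (|C.e| * (δA * (P.d * ((P.L : ℝ) ^ k * Sbox))) * P.mesh 0 * (P.d * ((P.L : ℝ) ^ k - 1))) * (c₁ * tPhi * pℓ)
                  + |C.e| * (δA * (P.d * ((P.L : ℝ) ^ k * Sbox))) * (P.d * (2 * (B1.aSeq a P.L k * (P.mesh k)⁻¹ ^ 2 * (c₁ * tPhi * pℓ) * D₄ * P.mesh k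
                        + |C.e| * (δA * (P.d * ((P.L : ℝ) ^ k * Sbox))) * (B1.aSeq a P.L k * D₃ * (c₁ * tPhi * pℓ))) + |C.e| * (δA * (P.d * ((P.L : ℝ) ^ k * Sbox))) * (B1.aSeq a P.L k * D₃ * (c₁ * tPhi * pℓ))))
                  + (P.mesh 0)⁻¹ * (|C.e| * δA) * (P.d * (B1.aSeq a P.L k * D₃ * (c₁ * tPhi * pℓ)))
                  + B1.aSeq a P.L k * (P.mesh k)⁻¹ ^ 2 *
                      ((2 * (|C.e| * (δA * (P.d * ((P.L : ℝ) ^ k * Sbox))) * P.mesh 0 * (P.d * ((P.L : ℝ) ^ k - 1)))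
                        + (|C.e| * (δA * (P.d * ((P.L : ℝ) ^ k * Sbox))) * P.mesh 0 * (P.d * ((P.L : ℝ) ^ k - 1))) ^ 2) * (B1.aSeq a P.L k * D₃ * (c₁ * tPhi * pℓ))))
              + (P.mesh 0)⁻¹ * (|C.e| * (δA * (P.d * ((P.L : ℝ) ^ k * Sbox)))) * (P.d * (B1.aSeq a P.L k * D₃ * (c₁ * tPhi * pℓ))) *
                  (D₅ * (∏ ν : Fin P.d, ((S ν).card : ℝ)) * (K₀ : ℝ) ^ (d - 1) * ((m₀ : ℝ) ^ d)⁻¹ * P.mesh 0))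
            + B1.aSeq a P.L k * C₃ * (P.mesh k)⁻¹ * (4 * K₀ * ((P.mesh k * (c₁ * pℓ) + P.mesh k * |C.e| * (δA * (P.d * ((P.L : ℝ) ^ k * Sbox))) * (c₁ * tPhi * pℓ)) * P.d) + Real.exp (-(1 / (4 * K₀) * ((R₁ : ℝ) + 1))) * (c₁ * tPhi * pℓ)) := by
  obtain ⟨K₀min, h⟩ := eq266_higgs_region d L hd hL ha hmsq N C ε₀ creg β hcreg hβ
  refine ⟨K₀min, fun K₀ hK₀ => ?_⟩
  obtain ⟨e₁, t, he₁, ht, C₁, C₂, C₃, D₂, D₃, D₄, D₅, hC₁, hC₂, hC₃, hD₂, hD₃, hD₄, hD₅, h⟩ := h K₀ hK₀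
  refine ⟨e₁, t, he₁, ht, C₁, C₂, C₃, D₂, D₃, D₄, D₅, hC₁, hC₂, hC₃, hD₂, hD₃, hD₄, hD₅, ?_⟩
  intro P hPd hPL hK₀M k hk1 hkK h3 hε h1 Λ₂ Λ₆ sq₂ sq₁ S q Sbox h62 hs2 h12 h16 hΩΛ hbox hSbox hsq₂ h2S q₁ R₁ hS₁ hsq₁ A δA hδA
    hgrad ht' ec hec hle hsmall x μ hx m₀ hm₀ hxm hcentre φ Λm1 A' c₁ pℓ tA tPhi hc₁ hpℓ htPhi h6m1 h255
  have hmesh : 0 < P.mesh k := P.mesh_pos k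
  -- (F9) the two `φ`-bounds READ OFF (2.55)
  have ht0 : 0 ≤ c₁ * tPhi * pℓ := mul_nonneg (mul_nonneg hc₁ htPhi) hpℓ
  have hφ : ∀ y ∈ Λ₆, ‖φ y‖ ≤ c₁ * tPhi * pℓ := norm_le_of_restr255 h255 h6m1
  have hcovA : ∀ (y : HiggsLattice.Site P k) (ν : Fin P.d), y ∈ sq₁ → y.shift ν ∈ sq₁ →
      ‖C.U (P.mesh k) (barA k A ⟨y, ν⟩) (φ (y.shift ν)) - φ y‖ ≤ P.mesh k * (c₁ * pℓ) :=
    fun y ν hy hyν => norm_transport_sub_le_of_restr255 h255 (h6m1 (h16 hy)) (h6m1 (h16 hyν))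
  -- (F8) (I.2.23) form on `B^k(Λ₂)` and the gradient form on `□` from the single hypothesis; `ȳ ∈ □₁`; `ρ := R₁ + 1`
  have hreg : ∀ z ∈ underRegion k Λ₂, ∀ μ ν : Fin P.d,
      P.mesh k * |C.e| / ec * |A ⟨z.shift μ, ν⟩ - A ⟨z, ν⟩| ≤ creg * ec ^ (β - 1) / (P.L : ℝ) ^ k :=
    fun z hz μ ν => reg223_of_grad C hec hsmall (hgrad z hz ν μ)
  have hregbox : ∀ z ∈ underRegion k sq₂, ∀ μ ν : Fin P.d, |A ⟨z.shift ν, μ⟩ - A ⟨z, μ⟩| ≤ δA := by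
    intro z hz μ' ν
    exact hgrad z ((mem_underRegion k Λ₂ z).mpr (hs2 ((mem_underRegion k sq₂ z).mp hz))) μ' ν
  have hxsq : blockIter k x ∈ sq₁ := (hsq₁ _).mpr (mem_box_of_centre q₁ (blockIter k x) R₁ hcentre)
  have hρ : ∀ y : HiggsLattice.Site P k, y ∉ sq₁ → ((R₁ : ℝ) + 1) ≤ (HiggsLattice.Site.tdist (blockIter k x) y : ℝ) := by
    intro y hy
    have h' := tdist_ge_of_not_mem_box q₁ (blockIter k x) R₁ hcentre (fun hh => hy ((hsq₁ y).mpr hh))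
    exact_mod_cast h'
  -- (F7) the constant field `A₀ := A(q̄)` and `s := δ_A·d·(LᵏS)` from the gradient bound on the box
  have hq : ∀ y ∈ sq₂, ∀ μ : Fin P.d, (y μ - q μ).val < Sbox := fun y hy => (hsq₂ y).mp hy
  have hs : (0 : ℝ) ≤ δA * (P.d * ((P.L : ℝ) ^ k * Sbox)) := by positivity
  have hAc : ∀ b : HiggsLattice.PBond P 0, Inside (underRegion k sq₂) b →
      |A b - (fun μ : Fin P.d => A ⟨toFinest q, μ⟩) b.dir| ≤ δA * (P.d * ((P.L : ℝ) ^ k * Sbox)) :=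
    fun b hb => abs_sub_corner_le_of_grad hkK q Sbox sq₂ hsq₂ h2S A hregbox b hb
  -- (F6) the Lipschitz modulus of the gauged field about `ȳ` on `□₁`, constant `(λ_A + (Lᵏε)|e|st′)·d`
  set c : Fin P.d → ℝ := fun μ : Fin P.d => A ⟨toFinest q, μ⟩ with hc
  have hcov : ∀ (y : HiggsLattice.Site P k) (ν : Fin P.d), (∀ ν', (y ν' - q₁ ν').val < 2 * R₁ + 1) →
      (∀ ν', ((y.shift ν) ν' - q₁ ν').val < 2 * R₁ + 1) →
      ‖C.U (P.mesh k) (c ν) (φ (y.shift ν)) - φ y‖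
        ≤ P.mesh k * (c₁ * pℓ) + P.mesh k * |C.e| * (δA * (P.d * ((P.L : ℝ) ^ k * Sbox))) * (c₁ * tPhi * pℓ) := by
    intro y ν hy hy'
    have hy1 : y ∈ sq₁ := (hsq₁ y).mpr hy
    have hy1' : y.shift ν ∈ sq₁ := (hsq₁ _).mpr hy'
    refine (cov_const_of_cov_barA C hkK sq₂ A c hAc φ (h12 hy1) (h12 hy1') (hcovA y ν hy1 hy1')).trans ?_
    have := hφ _ (h16 hy1')
    have hnn : 0 ≤ P.mesh k * |C.e| * (δA * (P.d * ((P.L : ℝ) ^ k * Sbox))) := by positivity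
    nlinarith
  set ψ := rot C (fun z => cornerGauge (toFinest q) c (toFinest z)) φ with hψ
  have hb : ∀ (y : HiggsLattice.Site P k) (ν : Fin P.d), (∀ ν', (y ν' - q₁ ν').val < 2 * R₁ + 1) →
      (∀ ν', ((y.shift ν) ν' - q₁ ν').val < 2 * R₁ + 1) →
      ‖ψ (y.shift ν) - ψ y‖ ≤ P.mesh k * (c₁ * pℓ) + P.mesh k * |C.e| * (δA * (P.d * ((P.L : ℝ) ^ k * Sbox))) * (c₁ * tPhi * pℓ) := by
    intro y ν hy hy'
    have hy2 : y ∈ sq₂ := h12 ((hsq₁ y).mpr hy)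
    have hy2' : y.shift ν ∈ sq₂ := h12 ((hsq₁ _).mpr hy')
    rw [hψ, norm_rot_cornerGauge_shift_sub C hkK q Sbox hSbox c φ (hq y hy2) (hq _ hy2')]
    exact hcov y ν hy hy'
  have hlamnn : 0 ≤ P.mesh k * (c₁ * pℓ) + P.mesh k * |C.e| * (δA * (P.d * ((P.L : ℝ) ^ k * Sbox))) * (c₁ * tPhi * pℓ) := by
    positivity
  have hlip : ∀ y ∈ sq₁, ‖ψ y - ψ (blockIter k x)‖
      ≤ (P.mesh k * (c₁ * pℓ) + P.mesh k * |C.e| * (δA * (P.d * ((P.L : ℝ) ^ k * Sbox))) * (c₁ * tPhi * pℓ)) * P.d *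
          (HiggsLattice.Site.tdist (blockIter k x) y : ℝ) :=
    fun y hy => lipschitz_about_of_bond_bound q₁ (2 * R₁ + 1) hS₁ ψ hlamnn hb ((hsq₁ y).mp hy) ((hsq₁ _).mp hxsq)
  have hlam' : 0 ≤ (P.mesh k * (c₁ * pℓ) + P.mesh k * |C.e| * (δA * (P.d * ((P.L : ℝ) ^ k * Sbox))) * (c₁ * tPhi * pℓ)) * P.d := by
    positivity
  have hmain := h P hPd hPL hK₀M hk1 hkK h3 hε h1 Λ₂ Λ₆ sq₂ sq₁ S q Sbox h62 hs2 h12 h16 hΩΛ hbox hSbox hq A hec hle hreg hδA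
    hregbox ht' c hs hAc x μ hx m₀ hm₀ hxm hxsq φ ht0 hφ hlam' hlip hρ
  exact hmain

end Eq266Restr

end Literature.MathematicalPhysics.QuantumFieldTheory.Balaban1983to89.B2Eq266Restrictions255

end
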